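import Summits.NavierStokesRegularity.JiaSverakCAP.GS17SpectrumAtZeroVector
import HarnessLib

/-!
# Guillod–Šverák Thm 2.1 (1), erratum E2 — part 4: the `|x|⁻²` decay of `v = ∇Φ × e₃` at infinity
# (`JiaSverakCAP.GS17SpectrumAtZero`, continued)

HONEST FRAMING (papers lane (c), PF-P2 writer seat papers-pfp2-w1 g3; companion of `GS17SpectrumAtZero` (p477988),
`GS17SpectrumAtZeroVector` (p479601), `GS17SpectrumAtZeroDivFree` (p487640)). One-variable bounds; asserts NOTHING about
Navier–Stokes or the cell's objects. Of the membership `v ∈ 𝒟` (the PF-P2 draft, §9 E2: `L² ∩ L⁴` decay of `v`, `∂^α v`, `x·∇v`)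
this module kernel-checks only the first, pointwise ingredient: `0 ≤ erf(r/2) ≤ 1` for `r ≥ 0` (`erfHalf_nonneg`,
`erfHalf_le_one`, from Mathlib's half-line Gaussian integral), `e^{−r²/4}/√π ≤ 4/(√π r²)` (`gaussHalf_le`),
`|φ'(r)| ≤ (4/√π + 1)/r²` for `r ≥ 1` (`abs_coulombGaussD1_le`), hence `|c_a(x)| ≤ (4/√π + 1)‖a‖/‖x‖²` for `‖x‖ ≥ 1`
(`abs_swirlComp_le`) — i.e. each Cartesian component of `v` decays like `|x|⁻²`. NOT kernel-checked: the decay of the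
derivatives `∂^α v`, `x·∇v`, the `L² ∩ L⁴` bookkeeping itself, the extension across `x = 0`, and the reading of the printed
operator (arXiv:1704.00560v1 only). [folklore]
-/

open scoped BigOperators RealInnerProductSpace
open Set MeasureTheory

noncomputable section

namespace Summit.NavierStokesRegularity.JiaSverakCAP.GS17SpectrumAtZero

/-- `0 ≤ erf(r/2)` for `r ≥ 0`. [folklore] -/
theorem erfHalf_nonneg {r : ℝ} (hr : 0 ≤ r) : 0 ≤ erfHalf r := by
  unfold erfHalf
  refine mul_nonneg (div_nonneg (by norm_num) (Real.sqrt_nonneg _)) ?_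
  exact intervalIntegral.integral_nonneg (by linarith) fun t _ => (Real.exp_pos _).le

/-- `∫₀^{r/2} e^{−t²} dt ≤ √π/2` for `r ≥ 0` (half-line Gaussian integral). [folklore] -/
theorem integral_exp_neg_sq_le {r : ℝ} (hr : 0 ≤ r) :
    ∫ t in (0 : ℝ)..(r / 2), Real.exp (-t ^ 2) ≤ Real.sqrt Real.pi / 2 := by
  rw [intervalIntegral.integral_of_le (by linarith : (0 : ℝ) ≤ r / 2)]
  have hint : IntegrableOn (fun t : ℝ => Real.exp (-t ^ 2)) (Ioi 0) := by
    have h := (integrable_exp_neg_mul_sq (b := (1 : ℝ)) one_pos).integrableOn (s := Ioi (0 : ℝ))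
    refine h.congr_fun (fun t _ => ?_) measurableSet_Ioi
    simp
  have h1 : ∫ t in Ioc (0 : ℝ) (r / 2), Real.exp (-t ^ 2) ≤ ∫ t in Ioi (0 : ℝ), Real.exp (-t ^ 2) :=
    setIntegral_mono_set hint (ae_of_all _ fun t => (Real.exp_pos _).le) Ioc_subset_Ioi_self.eventuallyLE
  have h2 : ∫ t in Ioi (0 : ℝ), Real.exp (-t ^ 2) = Real.sqrt Real.pi / 2 := by
    have h := integral_gaussian_Ioi (1 : ℝ)
    simp only [neg_mul, one_mul, div_one] at h
    exact h
  linarith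

/-- `erf(r/2) ≤ 1` for `r ≥ 0`. [folklore] -/
theorem erfHalf_le_one {r : ℝ} (hr : 0 ≤ r) : erfHalf r ≤ 1 := by
  unfold erfHalf
  have hπ : 0 < Real.sqrt Real.pi := Real.sqrt_pos.2 Real.pi_pos
  calc 2 / Real.sqrt Real.pi * ∫ t in (0 : ℝ)..(r / 2), Real.exp (-t ^ 2)
      ≤ 2 / Real.sqrt Real.pi * (Real.sqrt Real.pi / 2) :=
        mul_le_mul_of_nonneg_left (integral_exp_neg_sq_le hr) (div_nonneg (by norm_num) hπ.le)
    _ = 1 := by field_simp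

/-- `e^{−r²/4}/√π ≤ 4/(√π r²)` for `r ≠ 0` (from `1 + s ≤ e^s`). [folklore] -/
theorem gaussHalf_le {r : ℝ} (hr : r ≠ 0) : gaussHalf r ≤ 4 / (Real.sqrt Real.pi * r ^ 2) := by
  unfold gaussHalf
  have hπ : 0 < Real.sqrt Real.pi := Real.sqrt_pos.2 Real.pi_pos
  have hr2 : 0 < r ^ 2 := by positivity
  have hexp : Real.exp (-(r / 2) ^ 2) ≤ 4 / r ^ 2 := by
    have h1 : (r / 2) ^ 2 + 1 ≤ Real.exp ((r / 2) ^ 2) := Real.add_one_le_exp _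
    have h2 : Real.exp (-(r / 2) ^ 2) = (Real.exp ((r / 2) ^ 2))⁻¹ := Real.exp_neg _
    rw [h2]
    have h3 : (Real.exp ((r / 2) ^ 2))⁻¹ ≤ ((r / 2) ^ 2 + 1)⁻¹ :=
      inv_anti₀ (by positivity) h1
    have h4 : ((r / 2) ^ 2 + 1)⁻¹ ≤ ((r / 2) ^ 2)⁻¹ :=
      inv_anti₀ (by positivity) (by linarith)
    have h5 : ((r / 2) ^ 2)⁻¹ = 4 / r ^ 2 := by field_simp; ring
    linarith [h5.le, h5.ge]
  calc Real.exp (-(r / 2) ^ 2) / Real.sqrt Real.pi ≤ (4 / r ^ 2) / Real.sqrt Real.pi :=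
        div_le_div_of_nonneg_right hexp hπ.le
    _ = 4 / (Real.sqrt Real.pi * r ^ 2) := by rw [div_div, mul_comm]

/-- `0 ≤ gaussHalf r`. [folklore] -/
theorem gaussHalf_nonneg (r : ℝ) : 0 ≤ gaussHalf r :=
  div_nonneg (Real.exp_pos _).le (Real.sqrt_nonneg _)

/-- **Decay of `φ'`**: `|φ'(r)| ≤ (4/√π + 1)/r²` for `r ≥ 1`. [folklore] -/
theorem abs_coulombGaussD1_le {r : ℝ} (hr : 1 ≤ r) :
    |coulombGaussD1 r| ≤ (4 / Real.sqrt Real.pi + 1) / r ^ 2 := by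
  have hr0 : 0 < r := by linarith
  have hπ : 0 < Real.sqrt Real.pi := Real.sqrt_pos.2 Real.pi_pos
  unfold coulombGaussD1
  have hA : |gaussHalf r / r| ≤ 4 / Real.sqrt Real.pi / r ^ 2 := by
    rw [abs_of_nonneg (div_nonneg (gaussHalf_nonneg r) hr0.le)]
    calc gaussHalf r / r ≤ (4 / (Real.sqrt Real.pi * r ^ 2)) / r :=
          div_le_div_of_nonneg_right (gaussHalf_le hr0.ne') hr0.le
      _ ≤ (4 / (Real.sqrt Real.pi * r ^ 2)) / 1 :=
          div_le_div_of_nonneg_left (by positivity) one_pos hr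
      _ = 4 / Real.sqrt Real.pi / r ^ 2 := by rw [div_one, div_div]
  have hB : |erfHalf r / r ^ 2| ≤ 1 / r ^ 2 := by
    rw [abs_of_nonneg (div_nonneg (erfHalf_nonneg hr0.le) (by positivity))]
    exact div_le_div_of_nonneg_right (erfHalf_le_one hr0.le) (by positivity)
  calc |gaussHalf r / r - erfHalf r / r ^ 2| ≤ |gaussHalf r / r| + |erfHalf r / r ^ 2| := abs_sub _ _
    _ ≤ 4 / Real.sqrt Real.pi / r ^ 2 + 1 / r ^ 2 := add_le_add hA hB
    _ = (4 / Real.sqrt Real.pi + 1) / r ^ 2 := by ring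

/-- **`|x|⁻²` decay of the components of `v`**: `|c_a(x)| ≤ (4/√π + 1)·‖a‖/‖x‖²` for `‖x‖ ≥ 1`
(`c_a = swirlComp a = φ'(‖x‖)·⟪x, a⟫/‖x‖`). [folklore] -/
theorem abs_swirlComp_le {x : EuclideanSpace ℝ (Fin 3)} (hx : 1 ≤ ‖x‖) (a : EuclideanSpace ℝ (Fin 3)) :
    |swirlComp a x| ≤ (4 / Real.sqrt Real.pi + 1) * ‖a‖ / ‖x‖ ^ 2 := by
  have hx0 : 0 < ‖x‖ := by linarith
  have hπ : 0 < Real.sqrt Real.pi := Real.sqrt_pos.2 Real.pi_pos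
  -- `2 g'(‖x‖²) = φ'(‖x‖)/‖x‖`
  have hg : 2 * coulombGaussSqD1 (‖x‖ ^ 2) = coulombGaussD1 ‖x‖ / ‖x‖ := by
    unfold coulombGaussSqD1
    rw [Real.sqrt_sq hx0.le]
    field_simp
  have hinner : |⟪x, a⟫| ≤ ‖x‖ * ‖a‖ := abs_real_inner_le_norm x a
  have hφ := abs_coulombGaussD1_le hx
  unfold swirlComp
  rw [hg, abs_mul, abs_div, abs_of_pos hx0]
  calc |coulombGaussD1 ‖x‖| / ‖x‖ * |⟪x, a⟫|
      ≤ ((4 / Real.sqrt Real.pi + 1) / ‖x‖ ^ 2) / ‖x‖ * (‖x‖ * ‖a‖) := by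
        gcongr
    _ = (4 / Real.sqrt Real.pi + 1) * ‖a‖ / ‖x‖ ^ 2 := by
        field_simp

end Summit.NavierStokesRegularity.JiaSverakCAP.GS17SpectrumAtZero

end
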